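import Mathlib.RingTheory.Noetherian.Basic
import Literature.AlgebraicGeometry.Motives.FaltingsECProofs
import HarnessLib

/-!
# `M^div` is finitely generated: proof of the named fact `fg_divHull_homModule`
(Silverman, *AEC*, Thm. III.7.4, statement `(*)` of the proof)

Sibling file of `Literature.NumberTheory.EllipticCurves.IsogenyHom` (D-0014 append protocol). It
discharges the last of the three named facts of that file,
`WeierstrassCurve.fg_divHull_homModule W W'`: for elliptic curves `E, E'` over `K` and a finitely
generated subgroup `M ⊆ Hom_K(E, E')` (`homModule W W'`), the divisible hull
`M^div = {φ ∈ Hom_K(E, E') | m • φ ∈ M for some integer m ≥ 1}` (`divHull (homModule W W') M`) is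
finitely generated — Silverman, *The Arithmetic of Elliptic Curves*, 2nd ed., proof of
Thm. III.7.4, statement `(*)` (p. 85 of the held text).

## The argument

Silverman (loc. cit.): `deg` extends continuously to the real vector space `M ⊗ ℝ`;
`Hom(E₁, E₂)` is torsion-free (Prop. III.4.2(b)), so `M^div ⊂ M ⊗ ℝ`; and `M^div` meets the open
neighbourhood `{deg < 1}` of `0` only in `0`, every non-zero isogeny having degree `≥ 1`
(Cor. III.6.3: `deg` is a positive definite quadratic form); hence `M^div` is a discrete subgroup
of a finite-dimensional real vector space, so it is finitely generated.

Here the topological step is replaced by the integral linear algebra already used for the same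
purpose in `Literature.AlgebraicGeometry.Motives.FaltingsECProofs` ("the degree route",
`exists_pos_forall_smul_mem_of_parallelogram`), from the same two inputs:

1. *A uniform denominator* (`exists_pos_forall_mem_divHull_smul_mem`, pure algebra). Let `H` be a
   torsion-free abelian group, `M ⊆ S ⊆ H` subgroups with `M` finitely generated (hence free, with
   a `ℤ`-basis `b₁, …, b_r`), and `q : H → ℤ` a function satisfying the parallelogram law on `S`
   and positive on `M ∖ {0}`. The polar form `⟨x, y⟩ = q(x + y) - q(x) - q(y)` is then biadditive
   on `S` (Jordan–von Neumann over `ℤ`, `polar_add_left_of_parallelogram` of `FaltingsECProofs`),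
   its Gram matrix `G = (⟨bᵢ, bⱼ⟩)` has `det G ≠ 0` (a kernel vector `c ≠ 0` would give
   `2 q(∑ cᵢbᵢ) = cᵀ G c = 0`), and for `f ∈ S` with `m • f = ∑ aᵢ bᵢ ∈ M`, `m ≥ 1`, one has
   `G a = m w` with `wⱼ = ⟨bⱼ, f⟩ ∈ ℤ`, whence `det(G) a = adj(G) G a = m · adj(G) w` and, cancelling
   `m` in the torsion-free group `H`, `det(G) • f = ∑ (adj(G) w)ᵢ bᵢ ∈ M`. So `d = |det G|` has
   `d • f ∈ M` for every `f ∈ M^div`.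
2. *Finite generation* (`fg_divHull_of_forall_smul_mem`). With such a `d`, `f ↦ d • f` is an
   injective `ℤ`-linear map `M^div → M` into a finitely generated, hence Noetherian, `ℤ`-module, so
   `M^div` is finitely generated (Mathlib `Module.Finite.of_injective`).
3. *The inputs for `Hom_K(E, E')`* are theorems of the tree: `Hom(E(K̄), E'(K̄))` is torsion-free
   for `E` elliptic (`Literature.AlgebraicGeometry.Motives.noZeroSMulDivisors_int_addMonoidHom`, from the surjectivity of
   `[m]` on `E(K̄)`; Silverman's III.4.2(b)), and the polar degree `WeierstrassCurve.polarDegHom`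
   of `Literature.NumberTheory.EllipticCurves.IsogenyPolarDegree` satisfies the parallelogram law
   on `Hom_K(E, E')` (`polarDegHom_parallelogram`, Cor. III.6.3) and is positive on its non-zero
   elements (`polarDegHom_pos`, "every nonzero isogeny has degree at least one").

## References

* [SilvermanAEC2009] J. H. Silverman, *The Arithmetic of Elliptic Curves*, 2nd ed., GTM 106,
  Springer 2009, doi:10.1007/978-0-387-09494-6: III.§7, Thm. III.7.4, statement `(*)` of the
  proof (p. 85); Prop. III.4.2(b) (p. 68); Cor. III.6.3 (p. 80).

## Design choices

* `noncomputable section`, `open scoped Classical`, `K : Type u` as in the preludes; the two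
  generic lemmas live in `namespace Literature.NumberTheory.EllipticCurves` next to `divHull`, the
  discharge is a dot-notation extension in `namespace WeierstrassCurve` like the fact it proves.
* The file imports `Literature.AlgebraicGeometry.Motives.FaltingsECProofs` to *reuse* the
  torsion-freeness of `Hom(E(K̄), E'(K̄))` and the Jordan–von Neumann lemmas proved there rather
  than restate them; that file already imports `IsogenyHom` and `IsogenyPolarDegree`, and nothing
  imports the present file, so no cycle arises.
* No new definitions and no new named facts (D-0026): everything here is a theorem.
-/

noncomputable section

open scoped Classical

universe u v

/-! ## A uniform denominator for `M^div`, and its finite generation -/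

namespace Literature.NumberTheory.EllipticCurves

open QuadraticMap Matrix Literature.AlgebraicGeometry.Motives

section Saturation

variable {H : Type v} [AddCommGroup H] [NoZeroSMulDivisors ℤ H] {S M : Submodule ℤ H}

/-- **A uniform denominator for the divisible hull** (the Gram-determinant argument, see the
module docstring). Let `H` be a torsion-free abelian group, `M ⊆ S` subgroups of `H` with `M`
finitely generated, and `q : H → ℤ` a function satisfying the parallelogram law on `S` and positive
on `M ∖ {0}`. Then there is an integer `d ≥ 1` (namely `|det G|` for the Gram matrix `G` of the
polar form of `q` on a `ℤ`-basis of `M`) such that `d • f ∈ M` for every `f ∈ M^div = divHull S M`,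
i.e. for every `f ∈ S` having a positive multiple in `M`. This replaces Silverman's "`M^div` is a
discrete subgroup of `M ⊗ ℝ`" (*AEC*, proof of Thm. III.7.4, statement `(*)`). [folklore] -/
theorem exists_pos_forall_mem_divHull_smul_mem (hMS : M ≤ S) (hfg : M.FG) (q : H → ℤ)
    (hpar : ∀ x ∈ S, ∀ y ∈ S, q (x + y) + q (x - y) = 2 * q x + 2 * q y)
    (hpos : ∀ x ∈ M, x ≠ 0 → 0 < q x) :
    ∃ d : ℤ, 0 < d ∧ ∀ f ∈ divHull S M, d • f ∈ M := by
  classical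
  have h0 : q 0 = 0 := by have := hpar 0 S.zero_mem 0 S.zero_mem; simp at this; omega
  haveI : Module.Finite ℤ M := Module.Finite.iff_fg.mpr hfg
  haveI : Module.Free ℤ M := Module.free_of_finite_type_torsion_free'
  set ι := Module.Free.ChooseBasisIndex ℤ M
  set b : Module.Basis ι ℤ M := Module.Free.chooseBasis ℤ M with hb
  -- the basis vectors seen in `S`
  set bS : ι → S := fun i ↦ ⟨(b i : H), hMS (b i).2⟩ with hbS
  -- polar form, additive in the second variable on `S`
  choose B hB using fun (x : S) ↦ exists_polar_addMonoidHom hpar x.2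
  have hcoe : ∀ c : ι → ℤ, ((∑ i, c i • b i : M) : H) = ((∑ i, c i • bS i : S) : H) := by
    intro c
    simp [hbS]
  have hBsum : ∀ (x : S) (c : ι → ℤ),
      polar q (x : H) ((∑ i, c i • b i : M) : H) = ∑ i, c i * polar q (x : H) (b i : H) := by
    intro x c
    rw [hcoe, ← hB, map_sum]
    exact Finset.sum_congr rfl fun i _ ↦ by rw [map_zsmul, hB, smul_eq_mul]
  -- Gram matrix
  set G : Matrix ι ι ℤ := Matrix.of fun i j ↦ polar q (b i : H) (b j : H) with hG
  have hGmul : ∀ (c : ι → ℤ) (j : ι),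
      (G *ᵥ c) j = polar q (b j : H) ((∑ i, c i • b i : M) : H) := by
    intro c j
    rw [show polar q (b j : H) ((∑ i, c i • b i : M) : H) =
        polar q ((bS j : S) : H) ((∑ i, c i • b i : M) : H) from rfl, hBsum, Matrix.mulVec,
      dotProduct]
    exact Finset.sum_congr rfl fun i _ ↦ by rw [hG, Matrix.of_apply, mul_comm]
  have hpolar_self : ∀ x ∈ S, polar q x x = 2 * q x := by
    intro x hx
    have := hpar x hx x hx
    rw [sub_self, h0] at this
    rw [polar]; omega
  -- `det G ≠ 0` by positivity
  have hdet : G.det ≠ 0 := by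
    intro hdet
    obtain ⟨c, hc0, hGc⟩ := Matrix.exists_mulVec_eq_zero_iff.mpr hdet
    set χ : M := ∑ i, c i • b i with hχ
    have hχ0 : (χ : H) ≠ 0 := by
      intro h
      apply hc0
      have h' : χ = 0 := Subtype.ext h
      have hli := Fintype.linearIndependent_iff.mp b.linearIndependent c (by rw [← hχ, h'])
      exact funext hli
    have h1 : c ⬝ᵥ (G *ᵥ c) = polar q (χ : H) (χ : H) := by
      rw [dotProduct]
      calc ∑ j, c j * (G *ᵥ c) j = ∑ j, c j * polar q (χ : H) (b j : H) :=
            Finset.sum_congr rfl fun j _ ↦ by rw [hGmul, ← hχ, polar_comm]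
        _ = polar q (χ : H) (χ : H) := by
            rw [hχ]; exact (hBsum ⟨(χ : H), hMS χ.2⟩ c).symm
    rw [hGc, dotProduct_zero, hpolar_self _ (hMS χ.2)] at h1
    have := hpos _ χ.2 hχ0
    omega
  refine ⟨|G.det|, abs_pos.mpr hdet, fun f hf ↦ ?_⟩
  obtain ⟨hfS, m, hm, hmf⟩ := (mem_divHull_iff (N := S) (M := M)).mp hf
  have hm0 : m ≠ 0 := hm.ne'
  set ψ : M := ⟨m • f, hmf⟩ with hψ
  set a : ι → ℤ := fun i ↦ b.repr ψ i with ha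
  have hψsum : (∑ i, a i • b i : M) = ψ := by rw [ha]; exact b.sum_repr ψ
  -- `G a = m w` with `w j = ⟨b j, f⟩`
  set w : ι → ℤ := fun j ↦ polar q (b j : H) f with hw
  have hGa : ∀ j, (G *ᵥ a) j = m * w j := by
    intro j
    rw [hGmul, hψsum, hw]
    have := hB (bS j) (m • ⟨f, hfS⟩)
    rw [map_zsmul, hB, smul_eq_mul] at this
    simpa [hψ] using this.symm
  -- `det G • a = m • adj(G) w`
  have hdeta : ∀ i, G.det * a i = m * (G.adjugate *ᵥ w) i := by
    intro i
    have h1 : G.adjugate *ᵥ (G *ᵥ a) = G.det • a := by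
      rw [mulVec_mulVec, adjugate_mul, smul_mulVec, one_mulVec]
    have h2 : G *ᵥ a = m • w := funext fun j ↦ by rw [hGa, Pi.smul_apply, smul_eq_mul]
    rw [h2, mulVec_smul] at h1
    have := congrFun h1 i
    simp only [Pi.smul_apply, smul_eq_mul] at this
    exact this.symm
  -- hence `det G • f ∈ M`
  have hmem : G.det • f ∈ M := by
    have h2 : G.det • ψ = m • (∑ i, (G.adjugate *ᵥ w) i • b i : M) := by
      have : G.det • ψ = ∑ i, (G.det * a i) • b i := by
        rw [← hψsum, Finset.smul_sum]
        exact Finset.sum_congr rfl fun i _ ↦ by rw [smul_smul]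
      rw [this, Finset.smul_sum]
      exact Finset.sum_congr rfl fun i _ ↦ by rw [hdeta, ← smul_smul]
    have h1 : m • (G.det • f) = m • ((∑ i, (G.adjugate *ᵥ w) i • b i : M) : H) := by
      have := congrArg (Subtype.val : M → H) h2
      simp only [Submodule.coe_smul_of_tower, hψ] at this
      rw [smul_comm]
      exact this
    rw [smul_right_injective H hm0 h1]
    exact Submodule.coe_mem _
  rcases abs_choice G.det with h | h <;> rw [h]
  · exact hmem
  · rw [neg_smul]; exact M.neg_mem hmem

/-- **`M^div` is finitely generated once it has a uniform denominator**: if `M` is a finitely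
generated subgroup of the torsion-free abelian group `H` and `d ≠ 0` is an integer with `d • f ∈ M`
for all `f ∈ divHull S M`, then `divHull S M` is finitely generated — `f ↦ d • f` embeds it into the
Noetherian `ℤ`-module `M`. [folklore] -/
theorem fg_divHull_of_forall_smul_mem (hfg : M.FG) {d : ℤ} (hd : d ≠ 0)
    (h : ∀ f ∈ divHull S M, d • f ∈ M) : (divHull S M).FG := by
  haveI : Module.Finite ℤ M := Module.Finite.iff_fg.mpr hfg
  let g : divHull S M →ₗ[ℤ] M :=
    { toFun := fun f ↦ ⟨d • (f : H), h f f.2⟩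
      map_add' := fun f f' ↦ Subtype.ext (by simp [smul_add])
      map_smul' := fun c f ↦ Subtype.ext (by simp [smul_comm d c (f : H)]) }
  have hg : Function.Injective g := by
    intro f f' hff'
    have h' : d • (f : H) = d • (f' : H) := congrArg (Subtype.val : M → H) hff'
    exact Subtype.ext (smul_right_injective H hd h')
  exact Module.Finite.iff_fg.mp (Module.Finite.of_injective g hg)

/-- **`M^div` is finitely generated from a positive definite quadratic form** (the algebraic form
of statement `(*)` in the proof of *AEC* Thm. III.7.4): for a torsion-free abelian group `H`,
subgroups `M ⊆ S` with `M` finitely generated, and `q : H → ℤ` satisfying the parallelogram law on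
`S` and positive on `M ∖ {0}`, the divisible hull `divHull S M` is finitely generated. [folklore] -/
theorem fg_divHull_of_parallelogram (hMS : M ≤ S) (hfg : M.FG) (q : H → ℤ)
    (hpar : ∀ x ∈ S, ∀ y ∈ S, q (x + y) + q (x - y) = 2 * q x + 2 * q y)
    (hpos : ∀ x ∈ M, x ≠ 0 → 0 < q x) : (divHull S M).FG := by
  obtain ⟨d, hd, h⟩ := exists_pos_forall_mem_divHull_smul_mem hMS hfg q hpar hpos
  exact fg_divHull_of_forall_smul_mem hfg hd.ne' h

end Saturation

end Literature.NumberTheory.EllipticCurves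

/-! ## The discharge -/

namespace WeierstrassCurve

open Literature.NumberTheory.EllipticCurves Literature.AlgebraicGeometry.Motives

variable {K : Type u} [Field K] (W W' : WeierstrassCurve K)

/-- **Discharge of `WeierstrassCurve.fg_divHull_homModule`** — Silverman, *AEC*, Thm. III.7.4,
statement `(*)` of the proof: for elliptic curves `E, E'` over `K` and a finitely generated
subgroup `M ⊆ Hom_K(E, E')`, the divisible hull
`M^div = {φ ∈ Hom_K(E, E') | m • φ ∈ M for some m ≥ 1}` is finitely generated. Proof:
`fg_divHull_of_parallelogram` for the torsion-free group `Hom(E(K̄), E'(K̄))`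
(`noZeroSMulDivisors_int_addMonoidHom`, Prop. III.4.2(b)) and the polar degree `polarDegHom`,
which satisfies the parallelogram law on `Hom_K(E, E')` (`polarDegHom_parallelogram`,
Cor. III.6.3) and is `≥ 1` on its non-zero elements (`polarDegHom_pos`).
[cite: SilvermanAEC2009, Thm. III.7.4, proof, statement (*)] -/
theorem fg_divHull_homModule_holds : fg_divHull_homModule W W' := by
  intro _ _ M hM hfg
  haveI := noZeroSMulDivisors_int_addMonoidHom (W := W) (W' := W')
  exact fg_divHull_of_parallelogram hM hfg (polarDegHom (W := W) (W' := W'))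
    (fun f hf g hg ↦ polarDegHom_parallelogram hf hg)
    (fun f hf hf0 ↦ polarDegHom_pos (hM hf) hf0)

end WeierstrassCurve
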